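import Summits.ABC.StewartYu.PadicG3Setup
import Summits.ABC.StewartYu.SiegelOnFinset
import Mathlib.NumberTheory.Padics.RingHoms
import HarnessLib

/-!
# Cell abc-stewartyu, crux `Y07Odd` (stmt-ABC-19658), line `gen3-slab-odd`: the `p`-ADIC SLAB — the box of
# unknowns restricted to ONE class of (twist character × exponent form mod `p^{m+1}`) by a single pigeonhole

`Summits/ABC/StewartYu/PadicG3Slab.lean` — cell `abc-stewartyu` (HOME `run/shared/lean/pub/abc-stewartyu/`; K-M3.1
ledgers HOME/p2/K-M3-1-ledger-p2.md §2 and HOME/p1/K-M3-1-padic-ledger.md (Y18); seat p2-g4, F-odd lead).  Theorems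
and definitions; no named fact.  Sequel to `PadicG3Setup.lean`.

Yu 1999 (Acta Arith. 89, p. 340): «the crucial new idea … is to apply the pigeon-hole principle to the set of
integral points (λ₁,…,λ_r)» — the `p`-adic counterpart of Matveev's η-slab: among the points of the
height-weighted box `𝔅 = {λ ∈ ℤⁿ : |λⱼ| ≤ sⱼ}` one class of the map
`λ ↦ (∏ ηⱼ^{λⱼ}, p⁻¹·Σ λⱼ log_p ωⱼ mod p^m)` has at least `#𝔅/((p−1)·p^m)` elements; on it the twist class is
constant (so the values at integer points are rational up to a common root of unity — Siegel and Liouville over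
`ℚ`) AND all exponents `Σ λⱼ log_p ωⱼ` are congruent mod `p^{m+1}` (so the class functions are analytic on the
disc of radius `p^{m+θ₀}`: gain `(m+θ₀)·log p` per zero — `G3Setup.norm_eResc_le`).

* `G3Setup.box s` — the box as a `Finset (Fin n → ℤ)`, `card_box`;
* `G3Setup.rootSet`, `cls_mem_rootSet` (the twist class lives in `μ_{p−1}(ℚ_p)`, `≤ p − 1` values);
* `G3Setup.slabInt λ : ℤ_[p]` (`= p⁻¹ · Lsum λ`) and `slabCls m λ := toZModPow m (slabInt λ) ∈ ZMod (p^m)`, with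
  `norm_Lsum_sub_le_of_slabCls_eq` (equal classes ⇒ `‖Lsum λ − Lsum λ′‖ ≤ p^{−(m+1)}`);
* `G3Setup.exists_slab_class` — **the pigeonhole**: for every finite set `B` of exponent vectors there is
  `𝔏 ⊆ B` with `IsTwistClass 𝔏`, `IsSlab m 𝔏` and `#B ≤ (p−1)·p^m·#𝔏`.

WHAT THIS IS NOT: no Siegel step yet (that is `PadicG3Siegel.lean`, which runs `SiegelOnFinset` on `𝔏`); no crux moves.

## References
* K. Yu, Acta Arith. 89 (1999), p. 340; §10 (10.13)–(10.19). [Yu1999]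
* Yu. V. Nesterenko, LNM 1819 (2003), §3.4 (3.12)–(3.13) (the slab of W₀). [Nesterenko2003]
* K. Yu, Acta Math. 211 (2013), (4.19) (the twist class by pigeonhole). [Yu2013]
-/

noncomputable section

open Finset NormedSpace
open Literature.NumberTheory.Transcendental

namespace Summit.ABC.StewartYu

namespace G3Setup

variable {p : ℕ} [Fact p.Prime] (S : G3Setup p)

/-! ### The box -/

/-- Matveev's box `𝔅 = {λ ∈ ℤⁿ : |λⱼ| ≤ sⱼ}` (half-sides `sⱼ = ⌊L/(2Aⱼ)⌋`), as a finite set. [cite: Nesterenko2003, §3.4 (3.12)] -/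
def box (s : Fin S.n → ℕ) : Finset (Fin S.n → ℤ) :=
  Fintype.piFinset fun j => Icc (-(s j : ℤ)) (s j)

/-- Membership in the box. [folklore] -/
theorem mem_box {s : Fin S.n → ℕ} {lam : Fin S.n → ℤ} : lam ∈ S.box s ↔ ∀ j, |lam j| ≤ s j := by
  unfold box
  rw [Fintype.mem_piFinset]
  refine forall_congr' fun j => ?_
  rw [mem_Icc, abs_le]

/-- `#𝔅 = ∏ⱼ (2sⱼ + 1)`. [cite: Nesterenko2003, §3.4 (Prop 3.4: the count of points)] -/
theorem card_box (s : Fin S.n → ℕ) : (S.box s).card = ∏ j, (2 * s j + 1) := by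
  unfold box
  rw [Fintype.card_piFinset]
  refine prod_congr rfl fun j _ => ?_
  rw [Int.card_Icc]
  omega

/-! ### The twist class lives in the roots of unity -/

/-- `μ_{p−1}(ℚ_p)` as a finite set. [folklore] -/
def rootSet (p : ℕ) [Fact p.Prime] : Finset ℚ_[p] := Polynomial.nthRootsFinset (p - 1) (1 : ℚ_[p])

/-- `0 < p − 1`. [folklore] -/
theorem pred_pos (S : G3Setup p) : 0 < p - 1 := by have := S.hp3; omega

/-- `(cls λ)^{p−1} = 1`. [folklore] -/
theorem cls_pow (lam : Fin S.n → ℤ) : S.cls lam ^ (p - 1) = 1 := by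
  unfold cls
  rw [← prod_pow]
  exact prod_eq_one fun j _ => by rw [← zpow_natCast, ← zpow_mul, mul_comm, zpow_mul, zpow_natCast, S.hη j, one_zpow]

/-- `cls λ ∈ μ_{p−1}`. [folklore] -/
theorem cls_mem_rootSet (lam : Fin S.n → ℤ) : S.cls lam ∈ rootSet p := by
  unfold rootSet
  rw [Polynomial.mem_nthRootsFinset S.pred_pos]
  exact S.cls_pow lam

/-- `#μ_{p−1}(ℚ_p) ≤ p − 1`. [folklore] -/
theorem card_rootSet_le (p : ℕ) [Fact p.Prime] : (rootSet p).card ≤ p - 1 := by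
  classical
  unfold rootSet
  rw [Polynomial.nthRootsFinset_def]
  exact (Multiset.toFinset_card_le _).trans (Polynomial.card_nthRoots _ _)

/-- The twist class as an element of the finite type `↥μ_{p−1}`. [folklore] -/
def clsFin (lam : Fin S.n → ℤ) : ↥(rootSet p) := ⟨S.cls lam, S.cls_mem_rootSet lam⟩

/-! ### The slab class: `p⁻¹ Lsum λ mod p^m` -/

/-- `‖p⁻¹ · Lsum λ‖ ≤ 1`. [folklore] -/
theorem norm_inv_p_mul_Lsum_le (lam : Fin S.n → ℤ) : ‖(p : ℚ_[p])⁻¹ * S.Lsum lam‖ ≤ 1 := by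
  rw [norm_mul, norm_inv, norm_p']
  have hp : (0 : ℝ) < p := S.p_pos
  calc ((p : ℝ)⁻¹)⁻¹ * ‖S.Lsum lam‖ ≤ ((p : ℝ)⁻¹)⁻¹ * (p : ℝ)⁻¹ :=
        mul_le_mul_of_nonneg_left (S.norm_Lsum_le lam) (by positivity)
    _ = 1 := by rw [inv_inv, mul_inv_cancel₀ hp.ne']

/-- The `p`-adic integer `p⁻¹ · Lsum λ`. [cite: Yu1999, §10 (10.14)] -/
def slabInt (lam : Fin S.n → ℤ) : ℤ_[p] := ⟨(p : ℚ_[p])⁻¹ * S.Lsum lam, S.norm_inv_p_mul_Lsum_le lam⟩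

/-- **The slab class** `p⁻¹ · Lsum λ mod p^m ∈ ℤ/p^m`. [cite: Yu1999, p. 340, §10 (10.14)] -/
def slabCls (m : ℕ) (lam : Fin S.n → ℤ) : ZMod (p ^ m) := PadicInt.toZModPow m (S.slabInt lam)

/-- **Equal slab classes ⇒ the exponents are congruent mod `p^{m+1}`**: `‖Lsum λ − Lsum λ′‖ ≤ p^{−(m+1)}`.
[cite: Yu1999, §10 (10.15)] -/
theorem norm_Lsum_sub_le_of_slabCls_eq (m : ℕ) {lam lam' : Fin S.n → ℤ} (h : S.slabCls m lam = S.slabCls m lam') :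
    ‖S.Lsum lam - S.Lsum lam'‖ ≤ (p : ℝ)⁻¹ ^ (m + 1) := by
  have hker : S.slabInt lam - S.slabInt lam' ∈ RingHom.ker (PadicInt.toZModPow m : ℤ_[p] →+* ZMod (p ^ m)) := by
    rw [RingHom.mem_ker, map_sub, sub_eq_zero]
    exact h
  rw [PadicInt.ker_toZModPow, ← PadicInt.norm_le_pow_iff_mem_span_pow] at hker
  -- `‖slabInt λ − slabInt λ′‖ ≤ p^{−m}`; multiply by `‖p‖ = p⁻¹`
  have hnorm : ‖((p : ℚ_[p])⁻¹ * S.Lsum lam - (p : ℚ_[p])⁻¹ * S.Lsum lam')‖ ≤ (p : ℝ) ^ (-(m : ℤ)) := by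
    have : ‖S.slabInt lam - S.slabInt lam'‖ = ‖((p : ℚ_[p])⁻¹ * S.Lsum lam - (p : ℚ_[p])⁻¹ * S.Lsum lam')‖ := rfl
    rw [← this]; exact hker
  have hp : (p : ℚ_[p]) ≠ 0 := by exact_mod_cast (Fact.out : p.Prime).ne_zero
  have hp0 : (0 : ℝ) < p := S.p_pos
  have key : S.Lsum lam - S.Lsum lam' = (p : ℚ_[p]) * ((p : ℚ_[p])⁻¹ * S.Lsum lam - (p : ℚ_[p])⁻¹ * S.Lsum lam') := by
    rw [mul_sub, ← mul_assoc, mul_inv_cancel₀ hp, one_mul, ← mul_assoc, mul_inv_cancel₀ hp, one_mul]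
  rw [key, norm_mul, norm_p', pow_succ, mul_comm ((p : ℝ)⁻¹ ^ m)]
  refine mul_le_mul_of_nonneg_left (hnorm.trans (le_of_eq ?_)) (by positivity)
  rw [zpow_neg, zpow_natCast, inv_pow]

/-! ### The pigeonhole: one class of the box -/

/-- **THE SLAB BY PIGEONHOLE.**  For every finite set `B` of exponent vectors and every depth `m` there is a
subset `𝔏 ⊆ B` on which the twist class is constant and the exponents are congruent mod `p^{m+1}`, with
`#B ≤ (p−1)·p^m·#𝔏`. [cite: Yu1999, p. 340, §10 (10.14)] [cite: Yu2013, (4.19)] -/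
theorem exists_slab_class (m : ℕ) (B : Finset (Fin S.n → ℤ)) :
    ∃ 𝔏 : Finset (Fin S.n → ℤ), 𝔏 ⊆ B ∧ S.IsTwistClass 𝔏 ∧ S.IsSlab m 𝔏 ∧
      B.card ≤ (p - 1) * p ^ m * 𝔏.card := by
  classical
  haveI : Nonempty (↥(rootSet p) × ZMod (p ^ m)) :=
    ⟨(⟨S.cls 0, S.cls_mem_rootSet 0⟩, 0)⟩
  haveI : NeZero (p ^ m) := ⟨pow_ne_zero _ (Fact.out : p.Prime).ne_zero⟩
  have hcard : Fintype.card (↥(rootSet p) × ZMod (p ^ m)) ≤ (p - 1) * p ^ m := by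
    rw [Fintype.card_prod, ZMod.card, Fintype.card_coe]
    exact Nat.mul_le_mul_right _ (card_rootSet_le p)
  obtain ⟨c, hc⟩ := SiegelFinset.exists_class_card_ge B (fun lam => (S.clsFin lam, S.slabCls m lam)) hcard
  refine ⟨B.filter fun lam => (S.clsFin lam, S.slabCls m lam) = c, filter_subset _ _, ?_, ?_, hc⟩
  · intro lam hl lam' hl'
    have h1 := (mem_filter.mp hl).2
    have h2 := (mem_filter.mp hl').2
    have : S.clsFin lam = S.clsFin lam' := by rw [(Prod.mk.inj h1).1, (Prod.mk.inj h2).1]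
    exact congrArg Subtype.val this
  · intro lam hl lam' hl'
    have h1 := (mem_filter.mp hl).2
    have h2 := (mem_filter.mp hl').2
    exact S.norm_Lsum_sub_le_of_slabCls_eq m (by rw [(Prod.mk.inj h1).2, (Prod.mk.inj h2).2])

/-- **The slab of the box** (the index set `𝔏` of the unknowns, p1's symbol): `𝔏 ⊆ 𝔅`, one twist class, one
slab class of depth `m`, and `∏ⱼ(2sⱼ+1) ≤ (p−1)·p^m·#𝔏`. [cite: Yu1999, p. 340] [cite: Nesterenko2003, §3.4–3.5] -/
theorem exists_slab_box (m : ℕ) (s : Fin S.n → ℕ) :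
    ∃ 𝔏 : Finset (Fin S.n → ℤ), 𝔏 ⊆ S.box s ∧ S.IsTwistClass 𝔏 ∧ S.IsSlab m 𝔏 ∧
      ∏ j, (2 * s j + 1) ≤ (p - 1) * p ^ m * 𝔏.card := by
  obtain ⟨𝔏, h1, h2, h3, h4⟩ := S.exists_slab_class m (S.box s)
  exact ⟨𝔏, h1, h2, h3, by rwa [S.card_box] at h4⟩

end G3Setup

end Summit.ABC.StewartYu

end
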